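import Summits.RiemannHypothesis.RiemannHypothesis.Theorems.SignConeExactConeRigidityCaratheodoryDirichlet
import Literature.Analysis.SpecialFunctions.DigammaLogBound

/-!
# Route SignCone, item `ExactConeRigidity` (stmt-RiemannHypothesis-16306): the archimedean Laplace piece as a
Poisson integral

In the Carathéodory description of cone weights (`SignConeExactConeRigidityCaratheodoryDirichlet.lean`) the
archimedean term enters through `𝓐_G(z) = ∫₀^∞ W_∞(G(· - x)) e^{-zx} dx` (`G = g ⋆ g̃` a Weil test kernel,
`Re z > 0`).  Since `(G(· - x))^(1/2 + it) = e^{itx} Ĝ(1/2 + it)` and `Ĝ(1/2 + it) = |ĝ(1/2 + it)|²`, Fubini and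
`∫₀^∞ e^{-(z - it)x} dx = 1/(z - it)` give (`re_laplace_weilArchTerm_weilTranslate`)

  `Re 𝓐_G(z) = (1/2π) ∫ |ĝ(1/2+it)|² Re ψ(1/4 + it/2) · Re z / (Re z² + (Im z - t)²) dt - log π · Re ∫₀^∞ G(-x) e^{-zx} dx`,

a POISSON INTEGRAL of the archimedean density against `|ĝ|²`; for `z = s - 1/2` the kernel is the one displayed in
16303's registered `stub_cara`.  We also prove that the Poisson integral of `|Re ψ(1/4 + iv/2)|` converges
(`integrable_re_digamma_mul_poisson`: `|Re ψ| ≤ C + log(1+|v|) ≤ C' (1+|v|)^{1/2}` against a kernel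
`≤ K (1+|v|)^{-2}`), the dominating function for the shrinking-window limit.
-/

noncomputable section

-- `Summit.RiemannHypothesis.RiemannHypothesis.…` repeats a namespace component by design (D-0017 layout).
set_option linter.dupNamespace false

open scoped BigOperators ComplexConjugate Real Topology
open Complex MeasureTheory Set Filter

namespace Summit.RiemannHypothesis.RiemannHypothesis.Theorems.SignConeExactConeRigidity

open Literature.NumberTheory.LFunctions
open Summit.RiemannHypothesis.RiemannHypothesis.Theorems.SignCone
open Summit.RiemannHypothesis.RiemannHypothesis.Theorems.RuelleBandCofiniteCriticalLine

/-! ## The Poisson integral of the archimedean density converges -/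

/-- The archimedean density `v ↦ Re ψ(1/4 + iv/2)` is continuous. -/
theorem continuous_re_digamma_quarter :
    Continuous fun v : ℝ => (Complex.digamma (1 / 4 + v / 2 * I)).re := by
  have hw : ∀ t : ℝ, (1 / 4 : ℂ) + (t : ℂ) / 2 * I = ((1 / 4 : ℝ) : ℂ) + ((t / 2 : ℝ) : ℂ) * I := by
    intro t; push_cast; ring
  refine Complex.continuous_re.comp ?_
  refine Literature.Analysis.SpecialFunctions.Complex.continuousOn_digamma.comp_continuous
    (by fun_prop) fun t => ?_
  rw [hw t]
  simp

/-- A crude bound `|Re ψ(1/4 + iv/2)| ≤ C (1 + |v|)^{1/2}` with `C ≥ 0`. -/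
theorem exists_abs_re_digamma_quarter_le :
    ∃ C : ℝ, 0 ≤ C ∧ ∀ v : ℝ, |(Complex.digamma (1 / 4 + v / 2 * I)).re| ≤ C * (1 + |v|) ^ (1 / 2 : ℝ) := by
  obtain ⟨C, hC⟩ :=
    Literature.Analysis.SpecialFunctions.Complex.exists_norm_digamma_vertical_le (a := 1 / 4) (by norm_num)
  refine ⟨max C 0 + 2, by positivity, fun v => ?_⟩
  have hw : (1 / 4 : ℂ) + (v : ℂ) / 2 * I = ((1 / 4 : ℝ) : ℂ) + ((v / 2 : ℝ) : ℂ) * I := by push_cast; ring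
  have h1 : |(Complex.digamma (1 / 4 + v / 2 * I)).re| ≤ ‖Complex.digamma (1 / 4 + v / 2 * I)‖ :=
    Complex.abs_re_le_norm _
  have h2 := hC (v / 2)
  rw [← hw] at h2
  have h3 : Real.log (1 + |v / 2|) ≤ Real.log (1 + |v|) := by
    refine Real.log_le_log (by positivity) ?_
    rw [abs_div, abs_two]
    linarith [abs_nonneg v]
  have h4 : Real.log (1 + |v|) ≤ 2 * (1 + |v|) ^ (1 / 2 : ℝ) := by
    have h := Real.log_le_rpow_div (x := 1 + |v|) (ε := 1 / 2) (by positivity) (by norm_num)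
    linarith
  have h5 : (1 : ℝ) ≤ (1 + |v|) ^ (1 / 2 : ℝ) := Real.one_le_rpow (by linarith [abs_nonneg v]) (by norm_num)
  have hC0 : C ≤ max C 0 := le_max_left _ _
  have hm0 : 0 ≤ max C 0 := le_max_right _ _
  nlinarith

/-- The Poisson kernel is dominated by `(1 + |v|)^{-2}`: for `d > 0`,
`d / (d² + (τ - v)²) ≤ 2 d (1 + |τ|)² (1 + 1/d²) (1 + |v|)^{-2}`. -/
theorem poisson_le_rpow {d : ℝ} (hd : 0 < d) (τ v : ℝ) :
    d / (d ^ 2 + (τ - v) ^ 2) ≤ 2 * d * (1 + |τ|) ^ 2 * (1 + 1 / d ^ 2) * (1 + |v|) ^ (-2 : ℝ) := by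
  have hD : 0 < d ^ 2 + (τ - v) ^ 2 := by positivity
  have hv0 : 0 < 1 + |v| := by positivity
  -- `(1+|v|)² ≤ 2 (1+|τ|)² (1 + 1/d²) (d² + (τ-v)²)`
  have h1 : 1 + |v| ≤ (1 + |τ|) * (1 + |v - τ|) := by
    have : |v| ≤ |τ| + |v - τ| := by
      have := abs_add_le τ (v - τ); rwa [add_sub_cancel] at this
    nlinarith [abs_nonneg τ, abs_nonneg (v - τ)]
  have h2 : (1 + |v - τ|) ^ 2 ≤ 2 * (1 + (v - τ) ^ 2) := by
    have e : |v - τ| ^ 2 = (v - τ) ^ 2 := sq_abs _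
    nlinarith [abs_nonneg (v - τ), sq_nonneg (|v - τ| - 1)]
  have h3 : 1 + (v - τ) ^ 2 ≤ (1 + 1 / d ^ 2) * (d ^ 2 + (τ - v) ^ 2) := by
    have hd2 : 0 < d ^ 2 := by positivity
    have e : (v - τ) ^ 2 = (τ - v) ^ 2 := by ring
    rw [e]
    have : (1 + 1 / d ^ 2) * (d ^ 2 + (τ - v) ^ 2) = d ^ 2 + (τ - v) ^ 2 + 1 + (τ - v) ^ 2 / d ^ 2 := by
      field_simp
      ring
    rw [this]
    have : 0 ≤ (τ - v) ^ 2 / d ^ 2 := by positivity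
    nlinarith
  have h4 : (1 + |v|) ^ 2 ≤ 2 * (1 + |τ|) ^ 2 * (1 + 1 / d ^ 2) * (d ^ 2 + (τ - v) ^ 2) := by
    have hτ : 0 ≤ 1 + |τ| := by positivity
    calc (1 + |v|) ^ 2 ≤ ((1 + |τ|) * (1 + |v - τ|)) ^ 2 := by
            exact pow_le_pow_left₀ hv0.le h1 2
      _ = (1 + |τ|) ^ 2 * (1 + |v - τ|) ^ 2 := by ring
      _ ≤ (1 + |τ|) ^ 2 * (2 * (1 + (v - τ) ^ 2)) := by
            exact mul_le_mul_of_nonneg_left h2 (by positivity)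
      _ ≤ (1 + |τ|) ^ 2 * (2 * ((1 + 1 / d ^ 2) * (d ^ 2 + (τ - v) ^ 2))) := by
            exact mul_le_mul_of_nonneg_left (mul_le_mul_of_nonneg_left h3 (by norm_num)) (by positivity)
      _ = _ := by ring
  have hr : (1 + |v|) ^ (-2 : ℝ) = 1 / (1 + |v|) ^ 2 := by
    rw [Real.rpow_neg hv0.le, show (2 : ℝ) = ((2 : ℕ) : ℝ) by norm_num, Real.rpow_natCast, one_div]
  rw [hr, div_le_iff₀ hD]
  have hv2 : 0 < (1 + |v|) ^ 2 := by positivity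
  calc d = d * (1 + |v|) ^ 2 * (1 / (1 + |v|) ^ 2) := by field_simp
    _ ≤ d * (2 * (1 + |τ|) ^ 2 * (1 + 1 / d ^ 2) * (d ^ 2 + (τ - v) ^ 2)) * (1 / (1 + |v|) ^ 2) := by
          exact mul_le_mul_of_nonneg_right (mul_le_mul_of_nonneg_left h4 hd.le) (by positivity)
    _ = _ := by ring

/-- **The Poisson integral of the archimedean density converges**: for `d > 0` and real `τ`,
`v ↦ Re ψ(1/4 + iv/2) · d/(d² + (τ - v)²)` is integrable (dominated by a multiple of `(1 + |v|)^{-3/2}`). -/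
theorem integrable_re_digamma_mul_poisson {d : ℝ} (hd : 0 < d) (τ : ℝ) :
    Integrable fun v : ℝ => (Complex.digamma (1 / 4 + v / 2 * I)).re * (d / (d ^ 2 + (τ - v) ^ 2)) := by
  obtain ⟨C, hC0, hC⟩ := exists_abs_re_digamma_quarter_le
  set K : ℝ := 2 * d * (1 + |τ|) ^ 2 * (1 + 1 / d ^ 2) with hK
  have hK0 : 0 ≤ K := by positivity
  have hint : Integrable fun v : ℝ => C * K * (1 + ‖v‖) ^ (-(3 / 2) : ℝ) := by
    have h := (integrable_one_add_norm (E := ℝ) (μ := volume) (r := 3 / 2) (by simp; norm_num))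
    exact h.const_mul (C * K)
  refine hint.mono' ?_ (Eventually.of_forall fun v => ?_)
  · refine (continuous_re_digamma_quarter.mul ?_).aestronglyMeasurable
    refine Continuous.div continuous_const (by fun_prop) fun v => ?_
    positivity
  · have hv0 : 0 < 1 + |v| := by positivity
    have hP0 : 0 ≤ d / (d ^ 2 + (τ - v) ^ 2) := by positivity
    rw [Real.norm_eq_abs, abs_mul, abs_of_nonneg hP0, Real.norm_eq_abs]
    have e : (1 + |v|) ^ (-(3 / 2) : ℝ) = (1 + |v|) ^ (1 / 2 : ℝ) * (1 + |v|) ^ (-2 : ℝ) := by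
      rw [← Real.rpow_add hv0]; norm_num
    rw [e]
    calc |(Complex.digamma (1 / 4 + v / 2 * I)).re| * (d / (d ^ 2 + (τ - v) ^ 2))
        ≤ (C * (1 + |v|) ^ (1 / 2 : ℝ)) * (K * (1 + |v|) ^ (-2 : ℝ)) :=
          mul_le_mul (hC v) (poisson_le_rpow hd τ v) hP0 (by positivity)
      _ = _ := by ring

/-! ## The archimedean Laplace piece as a Poisson integral -/

variable {g : ℝ → ℂ}

/-- The archimedean integrand `Φ(t) = Ĝ(1/2 + it) Re ψ(1/4 + it/2)` of a Weil test kernel `G` is continuous. -/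
theorem continuous_weilArchIntegrand {G : ℝ → ℂ} (hG : IsWeilTest G) :
    Continuous fun t : ℝ => weilMellin G (1 / 2 + t * I) * ((Complex.digamma (1 / 4 + t / 2 * I)).re : ℂ) := by
  have hM : Continuous (weilMellin G) := (differentiable_weilMellin hG.1.continuous hG.2).continuous
  exact (hM.comp (by fun_prop)).mul (continuous_ofReal.comp continuous_re_digamma_quarter)

/-- `W_∞(G(· - x)) = (1/2π) ∫ e^{itx} Ĝ(1/2+it) Re ψ(1/4+it/2) dt - G(-x) log π`. -/
theorem weilArchTerm_weilTranslate_eq (G : ℝ → ℂ) (x : ℝ) :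
    weilArchTerm (weilTranslate G x) =
      (1 / (2 * π) : ℂ) * (∫ t : ℝ, cexp (t * x * I) *
        (weilMellin G (1 / 2 + t * I) * ((Complex.digamma (1 / 4 + t / 2 * I)).re : ℂ))) -
        G (-x) * (Real.log π : ℂ) := by
  unfold weilArchTerm weilArchIntegral
  have e : ∀ t : ℝ, weilMellin (weilTranslate G x) (1 / 2 + t * I) = cexp (t * x * I) * weilMellin G (1 / 2 + t * I) := by
    intro t
    rw [weilMellin_weilTranslate]
    congr 2
    ring
  simp_rw [e, mul_assoc]
  simp [weilTranslate]

/-- `∫₀^∞ e^{itx} e^{-zx} dx = 1/(z - it)` for `Re z > 0`. -/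
theorem integral_exp_I_mul_exp_neg {z : ℂ} (hz : 0 < z.re) (t : ℝ) :
    ∫ x in Ioi (0 : ℝ), cexp (t * x * I) * cexp (-(z * x)) = 1 / (z - t * I) := by
  have ha : ((t : ℂ) * I - z).re < 0 := by simp; linarith
  have h := integral_exp_mul_complex_Ioi ha 0
  have e : (fun x : ℝ => cexp (t * x * I) * cexp (-(z * x))) = fun x : ℝ => cexp ((t * I - z) * x) := by
    funext x; rw [← Complex.exp_add]; congr 1; ring
  rw [e, h]
  simp only [ofReal_zero, mul_zero, Complex.exp_zero]
  rw [show (t : ℂ) * I - z = -(z - t * I) by ring, div_neg, neg_div, neg_neg]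

/-- **Fubini for the archimedean Laplace piece**: for a Weil test kernel `G` and `Re z > 0`,
`∫₀^∞ (∫ e^{itx} Φ(t) dt) e^{-zx} dx = ∫ Φ(t)/(z - it) dt`, `Φ(t) = Ĝ(1/2+it) Re ψ(1/4+it/2)`. -/
theorem laplace_archIntegral_translate_eq {G : ℝ → ℂ} (hG : IsWeilTest G) {z : ℂ} (hz : 0 < z.re) :
    (∫ x in Ioi (0 : ℝ), (∫ t : ℝ, cexp (t * x * I) *
        (weilMellin G (1 / 2 + t * I) * ((Complex.digamma (1 / 4 + t / 2 * I)).re : ℂ))) * cexp (-(z * x))) =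
      ∫ t : ℝ, weilMellin G (1 / 2 + t * I) * ((Complex.digamma (1 / 4 + t / 2 * I)).re : ℂ) / (z - t * I) := by
  set Φ : ℝ → ℂ := fun t => weilMellin G (1 / 2 + t * I) * ((Complex.digamma (1 / 4 + t / 2 * I)).re : ℂ) with hΦ
  have hΦi : Integrable Φ := stub_branchesContinuous_integrable_weilArchIntegrand hG
  have hΦc : Continuous Φ := continuous_weilArchIntegrand hG
  -- the two-variable integrand and its integrability on `(0, ∞) × ℝ`
  set f : ℝ → ℝ → ℂ := fun x t => cexp (t * x * I) * Φ t * cexp (-(z * x)) with hf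
  have hfi : Integrable (Function.uncurry f) ((volume.restrict (Ioi (0 : ℝ))).prod volume) := by
    have hA : Integrable (fun x : ℝ => Real.exp (-z.re * x)) (volume.restrict (Ioi (0 : ℝ))) :=
      exp_neg_integrableOn_Ioi 0 hz
    have hB : Integrable (fun t : ℝ => ‖Φ t‖) volume := hΦi.norm
    have hdom : Integrable (fun p : ℝ × ℝ => Real.exp (-z.re * p.1) * ‖Φ p.2‖)
        ((volume.restrict (Ioi (0 : ℝ))).prod volume) := hA.mul_prod hB
    refine hdom.mono' ?_ (Eventually.of_forall fun p => ?_)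
    · exact (by fun_prop : Continuous (Function.uncurry f)).aestronglyMeasurable
    · simp only [Function.uncurry, hf]
      rw [norm_mul, norm_mul, Complex.norm_exp, Complex.norm_exp]
      have e1 : ((p.2 : ℂ) * (p.1 : ℂ) * I).re = 0 := by simp
      have e2 : (-(z * (p.1 : ℂ))).re = -z.re * p.1 := by simp [mul_re]
      rw [e1, e2, Real.exp_zero, one_mul, mul_comm]
  have hswap := integral_integral_swap hfi
  -- left side: pull `e^{-zx}` into the inner integral
  have hL : (∫ x in Ioi (0 : ℝ), (∫ t : ℝ, cexp (t * x * I) * Φ t) * cexp (-(z * x))) =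
      ∫ x in Ioi (0 : ℝ), ∫ t : ℝ, f x t := by
    refine integral_congr_ae (Eventually.of_forall fun x => ?_)
    simp only [hf]
    rw [← integral_mul_const]
  -- right side: evaluate the inner `x`-integral
  have hR : (∫ t : ℝ, ∫ x in Ioi (0 : ℝ), f x t) = ∫ t : ℝ, Φ t / (z - t * I) := by
    refine integral_congr_ae (Eventually.of_forall fun t => ?_)
    simp only [hf]
    have e : (fun x : ℝ => cexp (t * x * I) * Φ t * cexp (-(z * x))) =
        fun x : ℝ => Φ t * (cexp (t * x * I) * cexp (-(z * x))) := by
      funext x; ring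
    rw [e, integral_const_mul, integral_exp_I_mul_exp_neg hz t]
    ring
  rw [hL, hswap, hR]

/-- `Φ(t)/(z - it)` is integrable (`|1/(z - it)| ≤ 1/Re z`). -/
theorem integrable_weilArchIntegrand_div {G : ℝ → ℂ} (hG : IsWeilTest G) {z : ℂ} (hz : 0 < z.re) :
    Integrable fun t : ℝ => weilMellin G (1 / 2 + t * I) * ((Complex.digamma (1 / 4 + t / 2 * I)).re : ℂ) /
      (z - t * I) := by
  have hΦi := stub_branchesContinuous_integrable_weilArchIntegrand hG
  refine (hΦi.norm.mul_const (1 / z.re)).mono' ?_ (Eventually.of_forall fun t => ?_)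
  · refine ((continuous_weilArchIntegrand hG).div (by fun_prop) fun t h => ?_).aestronglyMeasurable
    have := congrArg Complex.re h
    simp at this
    linarith
  · rw [norm_div]
    have hzt : z.re ≤ ‖z - t * I‖ := by
      have h := Complex.abs_re_le_norm (z - t * I)
      have e : (z - (t : ℂ) * I).re = z.re := by simp
      rw [e, abs_of_pos hz] at h
      exact h
    have hpos : 0 < ‖z - t * I‖ := lt_of_lt_of_le hz hzt
    rw [div_le_iff₀ hpos]
    calc ‖weilMellin G (1 / 2 + t * I) * ((Complex.digamma (1 / 4 + t / 2 * I)).re : ℂ)‖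
        = ‖weilMellin G (1 / 2 + t * I) * ((Complex.digamma (1 / 4 + t / 2 * I)).re : ℂ)‖ * (1 / z.re) * z.re := by
          field_simp
      _ ≤ _ := mul_le_mul_of_nonneg_left hzt (by positivity)

/-- On the critical line the transform of `g ⋆ g̃` is `|ĝ|²`, so
`Re (Φ(t)/(z - it)) = |ĝ(1/2+it)|² Re ψ(1/4+it/2) · Re z/(Re z² + (Im z - t)²)`. -/
theorem re_weilArchIntegrand_div (hg : IsWeilTest g) (z : ℂ) (t : ℝ) :
    (weilMellin (weilConv g (weilReflect g)) (1 / 2 + t * I) * ((Complex.digamma (1 / 4 + t / 2 * I)).re : ℂ) /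
        (z - t * I)).re =
      Complex.normSq (weilMellin g (1 / 2 + t * I)) * (Complex.digamma (1 / 4 + t / 2 * I)).re *
        (z.re / (z.re ^ 2 + (z.im - t) ^ 2)) := by
  rw [weilMellin_weilQuadratic_of_re_eq hg (by simp), ← Complex.ofReal_mul, div_eq_mul_inv, Complex.re_ofReal_mul,
    Complex.inv_re, Complex.normSq_apply (z - t * I)]
  simp
  left
  ring

/-- **The archimedean Laplace piece as a Poisson integral.**  For a Weil test `g` (`G = g ⋆ g̃`) and `Re z > 0`:
`Re ∫₀^∞ W_∞(G(· - x)) e^{-zx} dx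
   = (1/2π) ∫ |ĝ(1/2+it)|² Re ψ(1/4+it/2) · Re z/(Re z² + (Im z - t)²) dt - log π · Re ∫₀^∞ G(-x) e^{-zx} dx`. -/
theorem re_laplace_weilArchTerm_weilTranslate (hg : IsWeilTest g) {z : ℂ} (hz : 0 < z.re) :
    (∫ x in Ioi (0 : ℝ), weilArchTerm (weilTranslate (weilConv g (weilReflect g)) x) * cexp (-(z * x))).re =
      1 / (2 * π) * (∫ t : ℝ, Complex.normSq (weilMellin g (1 / 2 + t * I)) *
          (Complex.digamma (1 / 4 + t / 2 * I)).re * (z.re / (z.re ^ 2 + (z.im - t) ^ 2))) -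
        Real.log π * (∫ x in Ioi (0 : ℝ), weilConv g (weilReflect g) (-x) * cexp (-(z * x))).re := by
  set G : ℝ → ℂ := weilConv g (weilReflect g) with hGdef
  have hGt : IsWeilTest G := hg.weilConv hg.weilReflect
  obtain ⟨M, hM⟩ := hGt.1.continuous.bounded_above_of_compact_support hGt.2
  set Φ : ℝ → ℂ := fun t => weilMellin G (1 / 2 + t * I) * ((Complex.digamma (1 / 4 + t / 2 * I)).re : ℂ) with hΦ
  have hΦi : Integrable Φ := stub_branchesContinuous_integrable_weilArchIntegrand hGt
  -- integrability of the two pieces of `W_∞(G(·-x)) e^{-zx}`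
  have hiA : IntegrableOn (fun x : ℝ => weilArchTerm (weilTranslate G x) * cexp (-(z * x))) (Ioi 0) := by
    refine integrableOn_mul_exp_of_bounded (continuous_weilArchTerm_weilTranslate hGt)
      (C := 1 / (2 * π) * (∫ t : ℝ, ‖weilMellin G (1 / 2 + t * I) *
        ((Complex.digamma (1 / 4 + t / 2 * I)).re : ℂ)‖) + M * Real.log π) (fun x _ => ?_) hz
    refine (norm_weilArchTerm_weilTranslate_le hGt x).trans (add_le_add le_rfl ?_)
    exact mul_le_mul_of_nonneg_right (hM _) (Real.log_nonneg (by linarith [Real.pi_gt_three]))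
  have hiG : IntegrableOn (fun x : ℝ => G (-x) * cexp (-(z * x))) (Ioi 0) :=
    integrableOn_mul_exp_of_bounded (hGt.1.continuous.comp continuous_neg) (C := M) (fun x _ => hM _) hz
  have hiGl : IntegrableOn (fun x : ℝ => G (-x) * (Real.log π : ℂ) * cexp (-(z * x))) (Ioi 0) := by
    have h : IntegrableOn (fun x : ℝ => G (-x) * cexp (-(z * x)) * (Real.log π : ℂ)) (Ioi 0) :=
      hiG.mul_const (Real.log π : ℂ)
    exact IntegrableOn.congr_fun h (fun x _ => by ring) measurableSet_Ioi
  -- the archimedean-integral piece, as `W_∞ e^{-zx} + G(-x) log π e^{-zx}`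
  have hiI : IntegrableOn (fun x : ℝ => (1 / (2 * π) : ℂ) * (∫ t : ℝ, cexp (t * x * I) * Φ t) * cexp (-(z * x))) (Ioi 0) := by
    have e : (fun x : ℝ => (1 / (2 * π) : ℂ) * (∫ t : ℝ, cexp (t * x * I) * Φ t) * cexp (-(z * x))) =
        fun x : ℝ => weilArchTerm (weilTranslate G x) * cexp (-(z * x)) + G (-x) * (Real.log π : ℂ) * cexp (-(z * x)) := by
      funext x
      simp only [hΦ]
      rw [weilArchTerm_weilTranslate_eq G x]
      ring
    rw [e]
    exact hiA.add hiGl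
  have hsplit : (∫ x in Ioi (0 : ℝ), weilArchTerm (weilTranslate G x) * cexp (-(z * x))) =
      (∫ x in Ioi (0 : ℝ), (1 / (2 * π) : ℂ) * (∫ t : ℝ, cexp (t * x * I) * Φ t) * cexp (-(z * x))) -
        ∫ x in Ioi (0 : ℝ), G (-x) * (Real.log π : ℂ) * cexp (-(z * x)) := by
    rw [← integral_sub hiI hiGl]
    refine integral_congr_ae (Eventually.of_forall fun x => ?_)
    simp only [hΦ]
    rw [weilArchTerm_weilTranslate_eq G x]
    ring
  have hI : (∫ x in Ioi (0 : ℝ), (1 / (2 * π) : ℂ) * (∫ t : ℝ, cexp (t * x * I) * Φ t) * cexp (-(z * x))) =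
      (1 / (2 * π) : ℂ) * ∫ t : ℝ, Φ t / (z - t * I) := by
    rw [← laplace_archIntegral_translate_eq hGt hz, ← integral_const_mul]
    refine integral_congr_ae (Eventually.of_forall fun x => ?_)
    simp only [hΦ]
    ring
  have hGl : (∫ x in Ioi (0 : ℝ), G (-x) * (Real.log π : ℂ) * cexp (-(z * x))) =
      (Real.log π : ℂ) * ∫ x in Ioi (0 : ℝ), G (-x) * cexp (-(z * x)) := by
    rw [← integral_const_mul]
    refine integral_congr_ae (Eventually.of_forall fun x => ?_)
    ring
  rw [hsplit, hI, hGl, Complex.sub_re, Complex.re_ofReal_mul]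
  congr 1
  have e2π : (1 / (2 * π) : ℂ) = ((1 / (2 * π) : ℝ) : ℂ) := by push_cast; ring
  rw [e2π, Complex.re_ofReal_mul]
  congr 1
  -- real part of `∫ Φ/(z - it)`
  have hre := integral_re (integrable_weilArchIntegrand_div hGt hz)
  simp only [RCLike.re_to_complex] at hre
  rw [← hre]
  refine integral_congr_ae (Eventually.of_forall fun t => ?_)
  exact re_weilArchIntegrand_div hg z t

end Summit.RiemannHypothesis.RiemannHypothesis.Theorems.SignConeExactConeRigidity

end
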